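import Summits.CriticalPhenomena.PercolationContinuityZ3.Theorems.PercNearOneGluingNoHeavyLowerTailThreePointPieces
import Summits.CriticalPhenomena.PercolationContinuityZ3.Theorems.PercNearOneGluingNoHeavyLowerTailThreePointHubGraphs
import HarnessLib

/-!
# `(3PT)` for parallel compositions of `(K)`-pieces — the theorem

Support file for crux `stmt-CriticalPhenomena-4575` (`NoHeavyLowerTail`), seat `prim-l12-p1` gen 20 (`--supports stmt-CriticalPhenomena-4575`);
continuation of `…ThreePointPieces.lean` (piece structures `part : V → ι`, piece pair sets `piecePairs`, cylinder events `isoPiece`, `isoP`,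
product formulas `real_isoP`, `real_sepP`, null event `badP`).  Memo `run/shared/lean/prim/prim-l12/FROM-prim-l12-p1-g20-*.md`.

`threePointVariance_of_pieces` [this work]: for bond percolation `prodBernoulli w` on a finite vertex type, pairwise distinct terminals
`a b c`, and a labelling `part : V → ι` such that non-terminals with different labels are never joined (weight `0`): if every piece `i`
satisfies the isolation criterion `(K)` of gen 19 (`ThreePointIsoProduct`) for its own four cylinder probabilities
`Qᵢ = P(a|b|c inside i)`, `Aᵢ = P(c isolated inside i)`, `Bᵢ = P(b isolated inside i)`, `Cᵢ = P(a isolated inside i)` —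
`Qᵢ³ ≤ Aᵢ²BᵢCᵢ`, `Qᵢ³ ≤ AᵢBᵢ²Cᵢ`, `Qᵢ³ ≤ AᵢBᵢCᵢ²` — then the three-point variance row holds:
`P(a↔b)·P(a↮b) ≤ P(a↔b, a↮c) + P(a↔c, a↮b) + P(b↔c, a↮b)`.
Proof: `Q, A, B, C` of the whole graph are the terminal-triangle factors times the products of the piece quantities (`real_isoP`,
`real_sepP`, transfer lemmas `real_isoPa/b/c`, `real_sepP'`), `(K)` is product-closed (`isoK_prod`) and holds for the triangle factor
(`tri_isoK`), and `(K) ⟹ 2Q − A ≤ (B+C−Q)²` (`threePoint_of_isoK`), which is `(3PT)` by the cell bookkeeping of Theorem H.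
Theorem H (`threePointVariance_hubGraph`) is the case "every piece is a single hub" (`star_isoK_*`); the series pieces of the next file
give the first pieces with internal structure.
-/

namespace Summit.CriticalPhenomena.PercolationContinuityZ3.Theorems.ThreePointPieces

open MeasureTheory Set
open Literature.Probability.Percolation Literature.Probability.LatticeModels
open Summit.CriticalPhenomena.PercolationContinuityZ3.Theorems.ThreePointHubEvents (tClosed real_tClosed real_tClosed_inter)

variable {V : Type*} [Fintype V] [DecidableEq V] {ι : Type*} [Fintype ι] [DecidableEq ι]

/-! ## The theorem -/

/-- **`(3PT)` for parallel compositions of `(K)`-pieces.**  Let `part : V → ι` label the vertices, and suppose every pair of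
non-terminal vertices with different labels has weight `0` (the weight function is a parallel composition, at `a, b, c`, of the pieces).
For piece `i` write `Qᵢ = P(a|b|c inside piece i)`, `Aᵢ = P(c isolated inside piece i)`, `Bᵢ = P(b isolated inside piece i)`,
`Cᵢ = P(a isolated inside piece i)` (the events `isoPiece (piecePairs a b c part i) · · ·`).  If every piece satisfies the isolation
criterion `(K)`: `Qᵢ³ ≤ Aᵢ²BᵢCᵢ`, `Qᵢ³ ≤ AᵢBᵢ²Cᵢ`, `Qᵢ³ ≤ AᵢBᵢCᵢ²`, then
`P(a↔b)·P(a↮b) ≤ P(a↔b, a↮c) + P(a↔c, a↮b) + P(b↔c, a↮b)`. [this work] -/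
theorem threePointVariance_of_pieces (w : Sym2 V → unitInterval) {a b c : V} (hab : a ≠ b) (hac : a ≠ c) (hbc : b ≠ c)
    (part : V → ι) (hw : ∀ u v : V, u ∉ terms a b c → v ∉ terms a b c → part u ≠ part v → (w s(u, v) : ℝ) = 0)
    (hKA : ∀ i, (prodBernoulli w).real (isoPiece (piecePairs a b c part i) a b c ∩ isoPiece (piecePairs a b c part i) b a c) ^ 3 ≤
      (prodBernoulli w).real (isoPiece (piecePairs a b c part i) c a b) ^ 2 *
        (prodBernoulli w).real (isoPiece (piecePairs a b c part i) b a c) * (prodBernoulli w).real (isoPiece (piecePairs a b c part i) a b c))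
    (hKB : ∀ i, (prodBernoulli w).real (isoPiece (piecePairs a b c part i) a b c ∩ isoPiece (piecePairs a b c part i) b a c) ^ 3 ≤
      (prodBernoulli w).real (isoPiece (piecePairs a b c part i) c a b) *
        (prodBernoulli w).real (isoPiece (piecePairs a b c part i) b a c) ^ 2 * (prodBernoulli w).real (isoPiece (piecePairs a b c part i) a b c))
    (hKC : ∀ i, (prodBernoulli w).real (isoPiece (piecePairs a b c part i) a b c ∩ isoPiece (piecePairs a b c part i) b a c) ^ 3 ≤
      (prodBernoulli w).real (isoPiece (piecePairs a b c part i) c a b) *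
        (prodBernoulli w).real (isoPiece (piecePairs a b c part i) b a c) * (prodBernoulli w).real (isoPiece (piecePairs a b c part i) a b c) ^ 2) :
    (prodBernoulli w).real (openConn a b) * (prodBernoulli w).real (openConn a b)ᶜ ≤
      (prodBernoulli w).real (openConn a b ∩ (openConn a c)ᶜ) + (prodBernoulli w).real (openConn a c ∩ (openConn a b)ᶜ) +
        (prodBernoulli w).real (openConn b c ∩ (openConn a b)ᶜ) := by
  have hN : (prodBernoulli w).real (badP a b c part) = 0 := real_badP w a b c part hw
  set μ := prodBernoulli w with hμ
  set IA : Set (BondConfig V) := (openConn a b)ᶜ ∩ (openConn a c)ᶜ with hIA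
  set IB : Set (BondConfig V) := (openConn a b)ᶜ ∩ (openConn b c)ᶜ with hIB
  set IC : Set (BondConfig V) := (openConn a c)ᶜ ∩ (openConn b c)ᶜ with hIC
  have hU : (openConn a b)ᶜ = IA ∪ IB := by
    ext ω
    simp only [hIA, hIB, mem_union, mem_inter_iff, mem_compl_iff]
    constructor
    · intro h
      by_cases hac' : ω ∈ openConn a c
      · exact Or.inr ⟨h, fun hbc' => h (SimpleGraph.Reachable.trans hac' (SimpleGraph.Reachable.symm hbc'))⟩
      · exact Or.inl ⟨h, hac'⟩
    · rintro (⟨h, -⟩ | ⟨h, -⟩) <;> exact h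
  have hCsub : IC ⊆ (openConn a b ∩ (openConn a c)ᶜ) ∪ (IA ∩ IB) := by
    intro ω hω
    obtain ⟨h1, h2⟩ := hω
    by_cases hab' : ω ∈ openConn a b
    · exact Or.inl ⟨hab', h1⟩
    · exact Or.inr ⟨⟨hab', h1⟩, hab', h2⟩
  have hBsub : IB ⊆ (openConn a c ∩ (openConn a b)ᶜ) ∪ (IA ∩ IB) := by
    intro ω hω
    obtain ⟨h1, h2⟩ := hω
    by_cases hac' : ω ∈ openConn a c
    · exact Or.inl ⟨hac', h1⟩
    · exact Or.inr ⟨⟨h1, hac'⟩, h1, h2⟩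
  have hAsub : IA ⊆ (openConn b c ∩ (openConn a b)ᶜ) ∪ (IA ∩ IB) := by
    intro ω hω
    obtain ⟨h1, h2⟩ := hω
    by_cases hbc' : ω ∈ openConn b c
    · exact Or.inl ⟨hbc', h1⟩
    · exact Or.inr ⟨⟨h1, h2⟩, h1, hbc'⟩
  have hθc : μ.real (openConn a b)ᶜ = μ.real IA + μ.real IB - μ.real (IA ∩ IB) := by
    have h := measureReal_union_add_inter (μ := μ) (s := IA) (t := IB) MeasurableSet.of_discrete
    rw [hU]; linarith
  have hθ : μ.real (openConn a b) = 1 - μ.real (openConn a b)ᶜ := by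
    have h := probReal_compl_eq_one_sub (μ := μ) (s := openConn a b) MeasurableSet.of_discrete
    linarith
  have hs : μ.real IC - μ.real (IA ∩ IB) ≤ μ.real (openConn a b ∩ (openConn a c)ᶜ) := by
    have h := (measureReal_mono (μ := μ) hCsub).trans (measureReal_union_le _ _)
    linarith
  have ht : μ.real IB - μ.real (IA ∩ IB) ≤ μ.real (openConn a c ∩ (openConn a b)ᶜ) := by
    have h := (measureReal_mono (μ := μ) hBsub).trans (measureReal_union_le _ _)
    linarith
  have hu : μ.real IA - μ.real (IA ∩ IB) ≤ μ.real (openConn b c ∩ (openConn a b)ᶜ) := by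
    have h := (measureReal_mono (μ := μ) hAsub).trans (measureReal_union_le _ _)
    linarith
  -- the criterion `(K)` for `Q = P(IA ∩ IB)`, `A = P(IC)`, `B = P(IB)`, `C = P(IA)`
  have hK : 2 * μ.real (IA ∩ IB) - μ.real IC ≤ (μ.real IB + μ.real IA - μ.real (IA ∩ IB)) ^ 2 := by
    set F : ι → Finset (Sym2 V) := fun i => piecePairs a b c part i with hF
    set PQ : ℝ := ∏ i ∈ (Finset.univ : Finset ι), μ.real (isoPiece (F i) a b c ∩ isoPiece (F i) b a c) with hPQ
    set PA : ℝ := ∏ i ∈ (Finset.univ : Finset ι), μ.real (isoPiece (F i) c a b) with hPA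
    set PB : ℝ := ∏ i ∈ (Finset.univ : Finset ι), μ.real (isoPiece (F i) b a c) with hPB
    set PC : ℝ := ∏ i ∈ (Finset.univ : Finset ι), μ.real (isoPiece (F i) a b c) with hPC
    set pab : ℝ := (w s(a, b) : ℝ)
    set pac : ℝ := (w s(a, c) : ℝ)
    set pbc : ℝ := (w s(b, c) : ℝ)
    have hpab : 0 ≤ 1 - pab := sub_nonneg.2 (unitInterval.le_one _)
    have hpac : 0 ≤ 1 - pac := sub_nonneg.2 (unitInterval.le_one _)
    have hpbc : 0 ≤ 1 - pbc := sub_nonneg.2 (unitInterval.le_one _)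
    have hpab1 : 1 - pab ≤ 1 := sub_le_self _ (unitInterval.nonneg _)
    have hpac1 : 1 - pac ≤ 1 := sub_le_self _ (unitInterval.nonneg _)
    have hpbc1 : 1 - pbc ≤ 1 := sub_le_self _ (unitInterval.nonneg _)
    have eQ : μ.real (IA ∩ IB) = (1 - pab) * (1 - pac) * (1 - pbc) * PQ := by
      rw [hIA, hIB, hμ, real_sepP' w part hab hac hbc hN, real_sepP, real_tClosed_inter w hab hac hbc]
    have eA : μ.real IC = (1 - pac) * (1 - pbc) * PA := by
      rw [hIC, hμ, real_isoPc w part hac hbc hN, real_isoP w a b c part (mem_terms.2 (Or.inr (Or.inr rfl))) (mem_terms.2 (Or.inl rfl)) (mem_terms.2 (Or.inr (Or.inl rfl))),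
        real_tClosed w hab, Sym2.eq_swap (a := c) (b := a), Sym2.eq_swap (a := c) (b := b)]
    have eB : μ.real IB = (1 - pab) * (1 - pbc) * PB := by
      rw [hIB, hμ, real_isoPb w part hab hbc hN, real_isoP w a b c part (mem_terms.2 (Or.inr (Or.inl rfl))) (mem_terms.2 (Or.inl rfl)) (mem_terms.2 (Or.inr (Or.inr rfl))),
        real_tClosed w hac, Sym2.eq_swap (a := b) (b := a)]
    have eC : μ.real IA = (1 - pab) * (1 - pac) * PC := by
      rw [hIA, hμ, real_isoPa w part hab hac hN, real_isoP w a b c part (mem_terms.2 (Or.inl rfl)) (mem_terms.2 (Or.inr (Or.inl rfl))) (mem_terms.2 (Or.inr (Or.inr rfl))),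
        real_tClosed w hbc]
    have hQnn : ∀ i ∈ (Finset.univ : Finset ι), 0 ≤ μ.real (isoPiece (F i) a b c ∩ isoPiece (F i) b a c) :=
      fun _ _ => measureReal_nonneg
    have hPQnn : 0 ≤ PQ := Finset.prod_nonneg hQnn
    have hKA' : PQ ^ 3 ≤ PA ^ 2 * PB * PC :=
      ThreePointIsoProduct.isoK_prod Finset.univ _ _ _ _ hQnn fun i _ => hKA i
    have hKB' : PQ ^ 3 ≤ PB ^ 2 * PA * PC :=
      ThreePointIsoProduct.isoK_prod Finset.univ _ _ _ _ hQnn fun i _ => (hKB i).trans_eq (by ring)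
    have hKC' : PQ ^ 3 ≤ PC ^ 2 * PA * PB :=
      ThreePointIsoProduct.isoK_prod Finset.univ _ _ _ _ hQnn fun i _ => (hKC i).trans_eq (by ring)
    have hTA := ThreePointHubGraphs.tri_isoK (q := 1 - pac) (r := 1 - pbc) hpab1 hpac hpbc
    have hTB := ThreePointHubGraphs.tri_isoK (q := 1 - pab) (r := 1 - pbc) hpac1 hpab hpbc
    have hTC := ThreePointHubGraphs.tri_isoK (q := 1 - pab) (r := 1 - pac) hpbc1 hpab hpac
    refine ThreePointIsoProduct.threePoint_of_isoK measureReal_nonneg ?_ ?_ ?_ ?_ ?_ ?_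
    · exact measureReal_mono fun ω ⟨⟨_, h2⟩, _, h3⟩ => ⟨h2, h3⟩
    · exact measureReal_mono fun ω ⟨_, h⟩ => h
    · exact measureReal_mono fun ω ⟨h, _⟩ => h
    · rw [eQ, eA, eB, eC]
      calc ((1 - pab) * (1 - pac) * (1 - pbc) * PQ) ^ 3 = ((1 - pab) * (1 - pac) * (1 - pbc)) ^ 3 * PQ ^ 3 := by ring
        _ ≤ ((1 - pac) * (1 - pbc)) ^ 2 * ((1 - pab) * (1 - pbc)) * ((1 - pab) * (1 - pac)) * (PA ^ 2 * PB * PC) :=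
            mul_le_mul hTA hKA' (pow_nonneg hPQnn 3) (mul_nonneg (mul_nonneg (sq_nonneg _) (mul_nonneg hpab hpbc)) (mul_nonneg hpab hpac))
        _ = _ := by ring
    · rw [eQ, eA, eB, eC]
      calc ((1 - pab) * (1 - pac) * (1 - pbc) * PQ) ^ 3 = ((1 - pac) * (1 - pab) * (1 - pbc)) ^ 3 * PQ ^ 3 := by ring
        _ ≤ ((1 - pab) * (1 - pbc)) ^ 2 * ((1 - pac) * (1 - pbc)) * ((1 - pac) * (1 - pab)) * (PB ^ 2 * PA * PC) :=
            mul_le_mul hTB hKB' (pow_nonneg hPQnn 3) (mul_nonneg (mul_nonneg (sq_nonneg _) (mul_nonneg hpac hpbc)) (mul_nonneg hpac hpab))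
        _ = _ := by ring
    · rw [eQ, eA, eB, eC]
      calc ((1 - pab) * (1 - pac) * (1 - pbc) * PQ) ^ 3 = ((1 - pbc) * (1 - pab) * (1 - pac)) ^ 3 * PQ ^ 3 := by ring
        _ ≤ ((1 - pab) * (1 - pac)) ^ 2 * ((1 - pbc) * (1 - pac)) * ((1 - pbc) * (1 - pab)) * (PC ^ 2 * PA * PB) :=
            mul_le_mul hTC hKC' (pow_nonneg hPQnn 3) (mul_nonneg (mul_nonneg (sq_nonneg _) (mul_nonneg hpbc hpac)) (mul_nonneg hpbc hpab))
        _ = _ := by ring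
  have h0 : 0 ≤ μ.real (openConn a b ∩ (openConn a c)ᶜ) := measureReal_nonneg
  rw [hθ, hθc]
  nlinarith [hK, hs, ht, hu]

end Summit.CriticalPhenomena.PercolationContinuityZ3.Theorems.ThreePointPieces
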